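import Mathlib
import Summits.AtomisticToContinuum.Crystallization.Theses.GappedShellCensus
import Literature.Geometry.DiscreteGeometry.DelaunaySubdivision
import Literature.Barriers.AtomisticToContinuum.StrongDodecahedralDih

/-!
# TornFree (stmt-AtomisticToContinuum-18069) — crux-ideate sketches, ideator 2 (round 1)

First-lemma signatures of the two idea cards `hole-census-euler` and `flat-edge-forcing`.
Nothing here is proved; every `def … : Prop` only has to elaborate.
-/

namespace Summit.AtomisticToContinuum.Crystallization.Cruxes.TornFree.SketchIdeator2

open Literature.Geometry.DiscreteGeometry

local notation "E3" => EuclideanSpace ℝ (Fin 3)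

/-- The route's inline hypothesis: every site of `Y` is gapped-twelve at scale `a`
(tolerance `1/50`, gap `63/50`), verbatim from `GappedShellCensus.TornFree`. -/
def AllGappedTwelve (Y : Set E3) (a : ℝ) : Prop :=
  ∀ y ∈ Y, ({w ∈ Y | w ≠ y ∧ dist y w ≤ a * (1 + 1 / 50)}.ncard = 12 ∧
    ∀ w ∈ Y, w ≠ y → a * (1 - 1 / 50) ≤ dist y w ∧ (dist y w ≤ a * (1 + 1 / 50) ∨ a * (63 / 50) ≤ dist y w))

/-- Sanity: the crux is `AllGappedTwelve`-hypothesised. -/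
example : Summit.AtomisticToContinuum.Crystallization.Theses.GappedShellCensus.TornFree ↔
    ∀ (Y : Set E3) (a : ℝ), 0 < a → AllGappedTwelve Y a → ∀ y ∈ Y, ∀ v ∈ Y, v ≠ y →
      dist y v ≤ a * (1 + 1 / 50) →
        4 ≤ {w ∈ Y | w ≠ y ∧ w ≠ v ∧ dist y w ≤ a * (1 + 1 / 50) ∧ dist v w ≤ a * (1 + 1 / 50)}.ncard :=
  Iff.rfl

/-! ## Card `hole-census-euler` -/

/-- A finite set of sites is a **quasi-octahedron** of `Y` at scale `a`: six sites of `Y`, each bonded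
(distance `≤ 1.02 a`) to exactly four of the other five (the fifth is then `≥ 1.26 a` away by the gap). -/
def IsQuasiOctahedron (Y : Set E3) (a : ℝ) (O : Finset E3) : Prop :=
  O.card = 6 ∧ (↑O : Set E3) ⊆ Y ∧
    ∀ p ∈ O, (O.filter fun q => q ≠ p ∧ dist p q ≤ a * (1 + 1 / 50)).card = 4

/-- **HoleDichotomy** (the card's transfer `C⁺`, stated on the canonical Delaunay subdivision
`Literature.Geometry.DiscreteGeometry.IsDelaunayCell`): in an all-gapped-twelve configuration every
Delaunay cell (the set of ALL sites on an empty sphere) is either a quasi-regular tetrahedron (four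
sites, all six pairs bonds) or lies inside a quasi-octahedron.  Equivalently: the only holes are
Bernal's (a) and (b); no tetragonal dodecahedron (snub disphenoid), capped trigonal prism, capped
antiprism or icosahedral cage. -/
def HoleDichotomy : Prop :=
  ∀ (Y : Set E3) (a : ℝ), 0 < a → AllGappedTwelve Y a → ∀ t : Set E3, IsDelaunayCell Y t →
    (t.ncard = 4 ∧ ∀ p ∈ t, ∀ q ∈ t, p ≠ q → dist p q ≤ a * (1 + 1 / 50)) ∨
      ∃ O : Finset E3, IsQuasiOctahedron Y a O ∧ t ⊆ ↑O

/-- **HoleVertexBound** (first checkable statement of the line, metric shadow of the Euler bound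
`Σ_v (6 − deg v) = 12` on a hole boundary): every empty open ball of an all-gapped-twelve
configuration has radius `< a` — no hole is larger than an icosahedral cage (circumradius
`0.951 a`); Bernal's capped antiprism (`1.128 a`) is already excluded. -/
def HoleRadiusBound : Prop :=
  ∀ (Y : Set E3) (a : ℝ), 0 < a → Y.Nonempty → AllGappedTwelve Y a → ∀ c : E3, ∃ y ∈ Y, dist c y < a

/-- **NoHexagonalWindow** (the one-centre input of the Euler bound, in a typable sufficient form):
in a gapped twelve-shell `T` (the hypotheses of `ShellTrichotomy`) there is no closed spherical cap of
angular radius `69°` (cos = `0.3584`) about a unit direction `u` that misses all twelve shell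
directions — i.e. the radial projection of `T` is a `69°`-covering of the sphere.  (A convex
hexagonal face of the bond mosaic has circumradius `≥ 73.8°`; so this excludes convex `k`-gonal
holes with `k ≥ 6`.  Non-convex faces are handled by the degree-`2` corner table.) -/
def NoHexagonalWindow : Prop :=
  ∀ T : Finset E3, T.card = 12 → (∀ v ∈ T, 1 - 1 / 50 ≤ ‖v‖ ∧ ‖v‖ ≤ 1 + 1 / 50) →
    (∀ v ∈ T, ∀ w ∈ T, v ≠ w → 1 - 1 / 50 ≤ dist v w ∧ (dist v w ≤ 1 + 1 / 50 ∨ 63 / 50 ≤ dist v w)) →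
      ∀ u : E3, ‖u‖ = 1 → ∃ v ∈ T, (0.3584 : ℝ) * ‖v‖ < inner ℝ u v

/-- `3 × 3` determinant of three vectors of `E3` (orientation / side-of-plane test). -/
noncomputable def det3 (x y z : E3) : ℝ :=
  Matrix.det !![x 0, x 1, x 2; y 0, y 1, y 2; z 0, z 1, z 2]

/-- **ReflexFree** (Step 0 of the line; a consequence of TornFree, plausibly a TWO-centre theorem at 2 %):
no bond of an all-gapped-twelve configuration is exposed to the void on more than a half-turn — for every
plane containing the bond, each closed side contains a common neighbour.  Equivalently: no hole has a
reflex edge.  (Two-endedness is all it should need: kit j021960 tests it on 21–23-point two-centre clusters.) -/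
def ReflexFree : Prop :=
  ∀ (Y : Set E3) (a : ℝ), 0 < a → AllGappedTwelve Y a → ∀ y ∈ Y, ∀ v ∈ Y, v ≠ y →
    dist y v ≤ a * (1 + 1 / 50) → ∀ n : E3, n ≠ 0 → inner ℝ n (v - y) = 0 →
      ∃ w ∈ Y, w ≠ y ∧ w ≠ v ∧ dist y w ≤ a * (1 + 1 / 50) ∧ dist v w ≤ a * (1 + 1 / 50) ∧
        0 ≤ inner ℝ n (w - y)

/-- **ConvexWindowBound** (Step 1, ONE-centre): in a gapped twelve-shell no CONVEX window has `≥ 6` sides —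
if `k ≥ 6` shell points `p₀ … p_{k−1}` are consecutively bonded and form a strictly convex spherical polygon
seen from the centre, some other shell point lies in the closed cone they span (the polygon is not a face of
the bond mosaic).  Non-convex windows with 6–7 sides DO occur at one centre (kit j021482: reflex corners
≈ 195° at degree-3 vertices, radii ≡ 1.02a) — they carry a reflex hole edge and are Step 0's business. -/
def ConvexWindowBound : Prop :=
  ∀ T : Finset E3, T.card = 12 → (∀ v ∈ T, 1 - 1 / 50 ≤ ‖v‖ ∧ ‖v‖ ≤ 1 + 1 / 50) →
    (∀ v ∈ T, ∀ w ∈ T, v ≠ w → 1 - 1 / 50 ≤ dist v w ∧ (dist v w ≤ 1 + 1 / 50 ∨ 63 / 50 ≤ dist v w)) →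
    ∀ k : ℕ, 6 ≤ k → ∀ p : ℕ → E3, (∀ i, p (i + k) = p i) → (∀ i, p i ∈ T) →
      (∀ i j, i < k → j < k → i ≠ j → p i ≠ p j) → (∀ i, dist (p i) (p (i + 1)) ≤ 1 + 1 / 50) →
      (∀ i, 0 < det3 (p i) (p (i + 1)) (p (i + 2))) →
        ∃ q ∈ T, (∀ i, q ≠ p i) ∧ ∀ i, 0 ≤ det3 (p i) (p (i + 1)) q

/-! ## Card `flat-edge-forcing` -/

/-- **Dihedral window of a quasi-regular tetrahedron** (Hales's `dih` in edge lengths,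
`Literature.Barriers.AtomisticToContinuum.dihY`): with all six edges in `[0.98, 1.02]` the dihedral
angle is within `0.062` rad (`3.6°`) of `arccos (1/3) = 70.53°`.  The first entry of the certified
table of cell-sector windows (T, O, and the exotic cages) on which the ring-word arithmetic runs. -/
def QuasiTetDihedralWindow : Prop :=
  ∀ y₁ y₂ y₃ y₄ y₅ y₆ : ℝ,
    y₁ ∈ Set.Icc (49 / 50 : ℝ) (51 / 50) → y₂ ∈ Set.Icc (49 / 50 : ℝ) (51 / 50) →
    y₃ ∈ Set.Icc (49 / 50 : ℝ) (51 / 50) → y₄ ∈ Set.Icc (49 / 50 : ℝ) (51 / 50) →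
    y₅ ∈ Set.Icc (49 / 50 : ℝ) (51 / 50) → y₆ ∈ Set.Icc (49 / 50 : ℝ) (51 / 50) →
      |Literature.Barriers.AtomisticToContinuum.dihY y₁ y₂ y₃ y₄ y₅ y₆ - Real.arccos (1 / 3)| ≤ 0.062

/-- **FlatSectorForcesTear** (the pigeonhole behind the card, metric form): around a bond `(y,v)` of
an all-gapped-twelve `Y`, if two common neighbours `w₁, w₂` span an EMPTY dihedral sector of opening
at least `164°` (no common neighbour `w` strictly inside the wedge), then the bond is torn
(`≤ 3` common neighbours) — because every other sector is `≥ 65.4°`.  Contrapositive use: TornFree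
forbids every hole with an edge of interior dihedral `≥ 164°` (snub disphenoid `166.4°`, capped
trigonal prism `169.5°`), before any completion computation. Stated with the wedge given by the
half-planes through `w₁`, `w₂` and measured by Hales's `dihY` on edge lengths. -/
def FlatSectorForcesTear : Prop :=
  ∀ (Y : Set E3) (a : ℝ), 0 < a → AllGappedTwelve Y a → ∀ y ∈ Y, ∀ v ∈ Y, ∀ w₁ ∈ Y, ∀ w₂ ∈ Y,
    v ≠ y → w₁ ≠ w₂ → dist y v ≤ a * (1 + 1 / 50) →
    dist y w₁ ≤ a * (1 + 1 / 50) → dist v w₁ ≤ a * (1 + 1 / 50) →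
    dist y w₂ ≤ a * (1 + 1 / 50) → dist v w₂ ≤ a * (1 + 1 / 50) →
    Real.pi * (164 / 180) ≤
      Literature.Barriers.AtomisticToContinuum.dihY (dist y v) (dist y w₁) (dist y w₂) (dist w₁ w₂)
        (dist v w₂) (dist v w₁) →
    -- the wedge between the half-planes (y v w₁), (y v w₂) on the side realising that dihedral is empty of
    -- common neighbours: every other common neighbour w sees w₁ and w₂ on the same side, i.e. the two
    -- dihedral angles (w₁ | w) and (w | w₂) along (y,v) do not add up to the (w₁ | w₂) one
    (∀ w ∈ Y, w ≠ y → w ≠ v → w ≠ w₁ → w ≠ w₂ → dist y w ≤ a * (1 + 1 / 50) → dist v w ≤ a * (1 + 1 / 50) →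
      Literature.Barriers.AtomisticToContinuum.dihY (dist y v) (dist y w₁) (dist y w) (dist w₁ w) (dist v w) (dist v w₁) +
        Literature.Barriers.AtomisticToContinuum.dihY (dist y v) (dist y w) (dist y w₂) (dist w w₂) (dist v w₂) (dist v w) ≠
      Literature.Barriers.AtomisticToContinuum.dihY (dist y v) (dist y w₁) (dist y w₂) (dist w₁ w₂) (dist v w₂) (dist v w₁)) →
    {w ∈ Y | w ≠ y ∧ w ≠ v ∧ dist y w ≤ a * (1 + 1 / 50) ∧ dist v w ≤ a * (1 + 1 / 50)}.ncard ≤ 3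

end Summit.AtomisticToContinuum.Crystallization.Cruxes.TornFree.SketchIdeator2
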